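import Summits.ResolutionOfSingularities.ResolutionOfSingularities.Theorems.EquisingularLiftEquisingularLiftNatExceptionalReducedModel
import Mathlib.RingTheory.Flat.TorsionFree
import Mathlib.AlgebraicGeometry.Morphisms.Flat
import HarnessLib

/-!
# [OURS · L1 W4.5(b) · EL♮(3) · T23-A′ (A′-3), DOWNSTAIRS HALF] The four local hypotheses at a transversal crossing point

Crux EL♮(3) = stmt-ResolutionOfSingularities-20148 (child of EL♮ stmt-…-20038; bookkeeping crux `EquisingularLift` stmt-…-15660); T23-A′ brick
**(A′-3)** (res-L1-w45b-stub-4 g10's SIG v2 767f3543c2b2e4ae; res-L1-w45b-plan-1 R12′ (iii) → res-L1-w45b-stub-2 g12). OURS; NOT a statement of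
H. Hironaka's 2017 manuscript; AI-written, weaker than expert review. No `sorry`; standard axioms; DEF-FREE.
`--supports stmt-ResolutionOfSingularities-20148 --as helper`.

WHAT. In the model square `jG : G → X` over `Spec θ` (`θ : O ↠ k`, `O` a DVR with uniformiser `ϖ`), for the centre `C` (reduced trace
`C·𝒪_G = 𝓘⟨Z⟩`, `V(C)` flat over `O`) and the member `𝓕` (trace `𝓘⟨F⟩`), stub-4's crossing hypotheses (T1) `𝓘⟨Z⟩_g + 𝓘⟨F⟩_g = 𝔪_{G,g}` and
(T2) `𝓘⟨Z⟩_g ≠ 𝔪_{G,g}` at `g ∈ Z ∩ F` become, at `x = jG g` with `p` the germ of `ϖ` (`transversal_downstairs_package`):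
(h1) `C_x + 𝓕_x + (p) = 𝔪_x`, (h2) `C_x + (p) ≠ 𝔪_x`, (h3) `C_x + (p)` radical, (h4) `p` is `C_x`-regular (`varpi_mul_mem_stalkIdeal_imp`, from
flatness) — exactly the inputs of the local half …NatTransversalTraceLocal `exists_rsop_transversal_crossing` (p609263). Tools: `jG♯_g` is onto with
kernel `(p)` (res-type-100's `stalkMap_model_surjective` / `ker_stalkMap_model_le` / `stalkMap_model_varpi`, …NatCarrierDeltaComapFrame).
Also `isRadical_map_of_bijective`. [cite: Liu2002, Thm. 8.1.19] [cite: Matsumura1987, Thm. 7.7]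
-/

set_option linter.dupNamespace false
set_option linter.overlappingInstances false -- the binders carry `[IsDomain O] [IsDiscreteValuationRing O]`

noncomputable section

open CategoryTheory CategoryTheory.Limits AlgebraicGeometry TopologicalSpace Topology IsLocalRing
open Literature.AlgebraicGeometry.Resolution
open AlgebraicGeometry.Scheme.IdealSheafData
open Summit.ResolutionOfSingularities.ResolutionOfSingularities.Cruxes.EquisingularLift.StrataSplit (stalkMap_Γgerm_apply')

namespace Summit.ResolutionOfSingularities.ResolutionOfSingularities.Cruxes.EquisingularLiftNat.Sections

/-! ## Small algebra -/

/-- The image of a radical ideal under a bijective ring map is radical. [folklore] -/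
theorem isRadical_map_of_bijective {A B : Type*} [CommRing A] [CommRing B] (f : A →+* B) (hf : Function.Bijective f)
    {I : Ideal A} (hI : I.IsRadical) : (I.map f).IsRadical := by
  have hker : RingHom.ker f ≤ I := by
    rw [(RingHom.injective_iff_ker_eq_bot f).mp hf.1]; exact bot_le
  intro x hx
  rw [← Ideal.map_radical_of_surjective hf.2 hker, hI.radical] at hx
  exact hx

/-! ## The downstairs hypotheses at a crossing point -/

section Downstairs

variable {O : Type} [CommRing O] [IsDomain O] [IsDiscreteValuationRing O] {k : Type} [Field k] {θ : O →+* k}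
  {P : Scheme.{0}} {q : P ⟶ Spec (.of O)} {G X : Scheme.{0}} {σ : X ⟶ P} {jG : G ⟶ X} {tG : G ⟶ Spec (.of k)}
  {C 𝓕 : X.IdealSheafData} {Z F : Set G} {hZ : IsClosed Z} {hF : IsClosed F}

omit [IsDiscreteValuationRing O] in
/-- **`ϖ` is `C_x`-regular at the points of the special fibre when `V(C)` is `O`-flat.** [cite: Matsumura1987, Thm. 7.7] [folklore] -/
theorem varpi_mul_mem_stalkIdeal_imp [IsLocallyNoetherian X] (hCflat : Flat (C.subschemeι ≫ σ ≫ q)) (ϖ : O) (hϖ0 : ϖ ≠ 0)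
    (x : X) (hxC : x ∈ C.support) (a : X.presheaf.stalk x)
    (ha : (X.presheaf.Γgerm x).hom ((σ ≫ q).appTop.hom ((Scheme.ΓSpecIso (.of O)).inv.hom ϖ)) * a ∈ stalkIdeal C x) :
    a ∈ stalkIdeal C x := by
  -- adapted from …NatTowerExceptionalDense `exists_specializes_mem_support_not_mem` (steps (1)–(3))
  obtain ⟨xc, hxc⟩ : x ∈ Set.range C.subschemeι := by rw [Scheme.IdealSheafData.range_subschemeι]; exact hxC
  subst hxc
  set ψ := (C.subschemeι.stalkMap xc).hom with hψ
  have hψker : RingHom.ker ψ = stalkIdeal C (C.subschemeι xc) := by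
    rw [hψ, ← stalkIdeal_ker_eq_ker_stalkMap, Scheme.IdealSheafData.ker_subschemeι]
  set ϖΓ : Γ(Spec (.of O), ⊤) := (Scheme.ΓSpecIso (.of O)).inv ϖ with hϖΓ
  set ϖs : (Spec (.of O)).presheaf.stalk ((σ ≫ q) (C.subschemeι xc)) :=
    ((Spec (CommRingCat.of O)).presheaf.Γgerm ((σ ≫ q) (C.subschemeι xc))).hom ϖΓ with hϖs
  have hϖA : (X.presheaf.Γgerm (C.subschemeι xc)).hom ((σ ≫ q).appTop.hom ϖΓ) = ((σ ≫ q).stalkMap (C.subschemeι xc)).hom ϖs := by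
    rw [hϖs, stalkMap_Γgerm_apply']
  -- (1) `ϖs` is a nonzerodivisor of the stalk of `Spec O`
  have hϖs_reg : ϖs ∈ nonZeroDivisors ((Spec (.of O)).presheaf.stalk ((σ ≫ q) (C.subschemeι xc))) := by
    letI : Algebra Γ(Spec (.of O), ⊤) ((Spec (CommRingCat.of O)).presheaf.stalk ((σ ≫ q) (C.subschemeι xc))) :=
      ((Spec (CommRingCat.of O)).presheaf.germ ⊤ ((σ ≫ q) (C.subschemeι xc)) trivial).hom.toAlgebra
    haveI := (isAffineOpen_top (Spec (.of O))).isLocalization_stalk ⟨(σ ≫ q) (C.subschemeι xc), trivial⟩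
    have hϖΓreg : ϖΓ ∈ nonZeroDivisors Γ(Spec (.of O), ⊤) := by
      refine mem_nonZeroDivisors_of_ne_zero ?_
      rw [hϖΓ]
      intro h0
      apply hϖ0
      have := congrArg (Scheme.ΓSpecIso (.of O)).hom h0
      simpa using this
    exact map_mem_nonZeroDivisors_of_isLocalization
      (((isAffineOpen_top (Spec (.of O))).primeIdealOf ⟨(σ ≫ q) (C.subschemeι xc), trivial⟩).asIdeal.primeCompl) _ hϖΓreg
  -- (2) flatness: `ψ (ϖ-germ)` is a nonzerodivisor of `𝒪_{V(C),xc}`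
  have hψϖ : ψ (((σ ≫ q).stalkMap (C.subschemeι xc)).hom ϖs) ∈ nonZeroDivisors (C.subscheme.presheaf.stalk xc) := by
    haveI : Flat (C.subschemeι ≫ σ ≫ q) := hCflat
    have hfl := Flat.stalkMap (C.subschemeι ≫ σ ≫ q) xc
    have hcomp : ((C.subschemeι ≫ σ ≫ q).stalkMap xc).hom ϖs = ψ (((σ ≫ q).stalkMap (C.subschemeι xc)).hom ϖs) := by
      rw [Scheme.Hom.stalkMap_comp]; rfl
    set g : ((Spec (.of O)).presheaf.stalk ((σ ≫ q) (C.subschemeι xc)) : Type) →+* (C.subscheme.presheaf.stalk xc : Type) :=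
      ((C.subschemeι ≫ σ ≫ q).stalkMap xc).hom with hg
    have hgfl : g.Flat := hfl
    letI : Algebra ((Spec (.of O)).presheaf.stalk ((σ ≫ q) (C.subschemeι xc)) : Type) (C.subscheme.presheaf.stalk xc : Type) := g.toAlgebra
    haveI : Module.Flat ((Spec (.of O)).presheaf.stalk ((σ ≫ q) (C.subschemeι xc)) : Type) (C.subscheme.presheaf.stalk xc : Type) := hgfl
    have hsm := Module.Flat.isSMulRegular_of_nonZeroDivisors (M := (C.subscheme.presheaf.stalk xc : Type)) hϖs_reg
    rw [← hcomp]
    refine mem_nonZeroDivisors_iff_right.mpr fun y hy => ?_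
    apply hsm
    change ϖs • y = ϖs • (0 : (C.subscheme.presheaf.stalk xc : Type))
    rw [smul_zero, Algebra.smul_def, RingHom.algebraMap_toAlgebra, mul_comm]
    exact hy
  -- (3) conclude
  rw [← hψker, RingHom.mem_ker]
  rw [hϖΓ] at hϖA
  rw [hϖA, ← hψker, RingHom.mem_ker, map_mul] at ha
  exact (mem_nonZeroDivisors_iff_right.mp hψϖ) _ (by rw [mul_comm]; exact ha)

/-- **The downstairs package at a crossing point `g ∈ Z ∩ F`**: with `p` the germ of the uniformiser at `x = jG g`, (h1) `C_x + 𝓕_x + (p) = 𝔪_x`,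
(h2) `C_x + (p) ≠ 𝔪_x`, (h3) `C_x + (p)` radical, (h4) `p` is `C_x`-regular — from (T1), (T2), the reduced trace `C·𝒪_G = 𝓘⟨Z⟩` and the
`O`-flatness of `V(C)`, through the surjection `jG♯_g` with kernel `(p)`. [cite: Liu2002, Thm. 8.1.19] [OURS · L1 W4.5b · T23-A′ (A′-3)] -/
theorem transversal_downstairs_package [IsLocallyNoetherian X] (hsq : IsPullback jG tG (σ ≫ q) (Spec.map (CommRingCat.ofHom θ)))
    (hθ : Function.Surjective θ) (ϖ : O) (hϖ : Irreducible ϖ)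
    (hC : C.comap jG = vanishingIdeal ⟨Z, hZ⟩) (hCflat : Flat (C.subschemeι ≫ σ ≫ q)) (hF1 : 𝓕.comap jG = vanishingIdeal ⟨F, hF⟩)
    (hT1 : ∀ g ∈ Z ∩ F, stalkIdeal (vanishingIdeal (⟨Z, hZ⟩ : Closeds G)) g ⊔ stalkIdeal (vanishingIdeal (⟨F, hF⟩ : Closeds G)) g =
      maximalIdeal (G.presheaf.stalk g))
    (hT2 : ∀ g ∈ Z ∩ F, stalkIdeal (vanishingIdeal (⟨Z, hZ⟩ : Closeds G)) g ≠ maximalIdeal (G.presheaf.stalk g))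
    (g : G) (hg : g ∈ Z ∩ F) :
    (stalkIdeal C (jG g) ⊔ stalkIdeal 𝓕 (jG g) ⊔
        Ideal.span {(X.presheaf.Γgerm (jG g)).hom ((σ ≫ q).appTop.hom ((Scheme.ΓSpecIso (.of O)).inv.hom ϖ))} = maximalIdeal _) ∧
    (stalkIdeal C (jG g) ⊔ Ideal.span {(X.presheaf.Γgerm (jG g)).hom ((σ ≫ q).appTop.hom ((Scheme.ΓSpecIso (.of O)).inv.hom ϖ))} ≠
        maximalIdeal _) ∧
    (stalkIdeal C (jG g) ⊔ Ideal.span {(X.presheaf.Γgerm (jG g)).hom ((σ ≫ q).appTop.hom ((Scheme.ΓSpecIso (.of O)).inv.hom ϖ))}).IsRadical ∧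
    (∀ a, (X.presheaf.Γgerm (jG g)).hom ((σ ≫ q).appTop.hom ((Scheme.ΓSpecIso (.of O)).inv.hom ϖ)) * a ∈ stalkIdeal C (jG g) →
        a ∈ stalkIdeal C (jG g)) := by
  set p := (X.presheaf.Γgerm (jG g)).hom ((σ ≫ q).appTop.hom ((Scheme.ΓSpecIso (.of O)).inv.hom ϖ)) with hp
  set φ := (jG.stalkMap g).hom with hφ
  have hφs : Function.Surjective φ := stalkMap_model_surjective θ hθ (σ ≫ q) jG tG hsq g
  have hφp : φ p = 0 := stalkMap_model_varpi θ hθ (σ ≫ q) jG tG hsq g ϖ (hϖ.maximalIdeal_eq ▸ Ideal.mem_span_singleton_self ϖ)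
  have hker : RingHom.ker φ = Ideal.span {p} := by
    refine le_antisymm (ker_stalkMap_model_le O k θ hθ (σ ≫ q) jG tG hsq g ϖ hϖ) ?_
    rw [Ideal.span_le, Set.singleton_subset_iff]; exact hφp
  have hCg : (stalkIdeal C (jG g)).map φ = stalkIdeal (vanishingIdeal (⟨Z, hZ⟩ : Closeds G)) g := by
    rw [hφ, ← stalkIdeal_comap_eq_map_stalkMap, hC]
  have hFg : (stalkIdeal 𝓕 (jG g)).map φ = stalkIdeal (vanishingIdeal (⟨F, hF⟩ : Closeds G)) g := by
    rw [hφ, ← stalkIdeal_comap_eq_map_stalkMap, hF1]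
  have hcomap𝔪 : (maximalIdeal (G.presheaf.stalk g)).comap φ = maximalIdeal _ :=
    IsLocalRing.eq_maximalIdeal (Ideal.comap_isMaximal_of_surjective φ hφs)
  have hcomapC : ((stalkIdeal C (jG g)).map φ).comap φ = stalkIdeal C (jG g) ⊔ Ideal.span {p} := by
    rw [Ideal.comap_map_of_surjective φ hφs, ← RingHom.ker_eq_comap_bot, hker]
  refine ⟨?_, ?_, ?_, ?_⟩
  · -- (h1) from (T1)
    have h := congrArg (Ideal.comap φ) (hT1 g hg)
    rwa [← hCg, ← hFg, ← Ideal.map_sup, Ideal.comap_map_of_surjective φ hφs, ← RingHom.ker_eq_comap_bot, hker, hcomap𝔪] at h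
  · -- (h2) from (T2)
    intro heq
    apply hT2 g hg
    have h := congrArg (Ideal.map φ) heq
    rwa [Ideal.map_sup, Ideal.map_span, Set.image_singleton, hφp, Ideal.span_singleton_zero, sup_bot_eq, hCg,
      IsLocalRing.map_maximalIdeal_of_surjective φ hφs] at h
  · -- (h3) from the reduced trace of `C`
    rw [← hcomapC, hCg]
    haveI := ComponentGluing.isReduced_subscheme_vanishingIdeal (⟨Z, hZ⟩ : Closeds G)
    exact (isRadical_stalkIdeal_of_isReduced_subscheme (vanishingIdeal (⟨Z, hZ⟩ : Closeds G)) g).comap φ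
  · -- (h4) from flatness
    have hxC : jG g ∈ C.support := by
      have h1 : g ∈ ((C.comap jG).support : Set G) := by
        rw [hC, Scheme.IdealSheafData.coe_support_vanishingIdeal]; exact hg.1
      rwa [Scheme.IdealSheafData.support_comap] at h1
    exact fun a ha => varpi_mul_mem_stalkIdeal_imp hCflat ϖ hϖ.ne_zero (jG g) hxC a ha

end Downstairs


end Summit.ResolutionOfSingularities.ResolutionOfSingularities.Cruxes.EquisingularLiftNat.Sections

end
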